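import Mathlib.Probability.Distributions.Gaussian.Fernique
import Literature.Probability.Distributions.GaussianCoordinateMoments
import Literature.Probability.Distributions.GaussianMoments
import HarnessLib

/-!
# Crux `SelfNormalisedSkewness` (stmt-QuantumFields-18944, line `Sketch`): stub D — Gaussian Wick squares

For the standard Gaussian `γ = stdGaussian W` of a finite-dimensional real inner product space `W`
and vectors `a b c : W`, write `A = ⟪a, ·⟫`, `B = ⟪b, ·⟫`, `C = ⟪c, ·⟫`. The centred ("Wick")
squares `A² - ‖a‖²` satisfy

* `E[(A² - ‖a‖²)(B² - ‖b‖²)] = 2 ⟪a, b⟫²`,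
* `E[(A² - ‖a‖²)(B² - ‖b‖²)(C² - ‖c‖²)] = 8 ⟪a, b⟫ ⟪b, c⟫ ⟪c, a⟫`

(Isserlis 1918 / Wick; Janson, *Gaussian Hilbert Spaces* (1997), Thm. 1.28), and finite products of
linear functionals are `γ`-integrable (Gaussian measures have all moments, Mathlib's
`IsGaussian.memLp_id`).

Proof by polarisation (no pairing combinatorics): the law of `⟪v, ·⟫` under `γ` is `𝒩(0, ‖v‖²)`
(`IsGaussian.map_eq_gaussianReal`, `variance_dual_stdGaussian`), whose even moments are
`‖v‖^{2r} (2r-1)‼` (tree `integral_pow_even_gaussianReal`); `A²B²` and `A²B²C²` are rational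
combinations of fourth, resp. sixth, powers of linear combinations `αA + βB + γC = ⟪αa + βb + γc, ·⟫`,
and `‖αa + βb + γc‖²` is the Gram quadratic form.
-/

noncomputable section

open MeasureTheory ProbabilityTheory
open scoped InnerProductSpace Nat ENNReal

namespace Summit.QuantumFields.YangMills.Theorems.SelfNormalisedSkewness.Negative

section WickSquaresHelpers

variable {W : Type*} [NormedAddCommGroup W] [InnerProductSpace ℝ W] [FiniteDimensional ℝ W]
  [MeasurableSpace W] [BorelSpace W]

/-- The law of the linear functional `⟪v, ·⟫` under the standard Gaussian is `𝒩(0, ‖v‖²)`. [folklore] -/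
theorem map_inner_stdGaussian (v : W) :
    (stdGaussian W).map (fun x => ⟪v, x⟫_ℝ) = gaussianReal 0 (‖v‖ ^ 2).toNNReal := by
  rw [show (fun x : W => ⟪v, x⟫_ℝ) = ⇑(innerSL ℝ v) from (coe_innerSL_apply (𝕜 := ℝ) v).symm,
    IsGaussian.map_eq_gaussianReal, integral_strongDual_stdGaussian, variance_dual_stdGaussian,
    innerSL_apply_norm]

/-- Even moments of a linear functional: `∫ ⟪v, x⟫^{2r} dγ = ‖v‖^{2r} (2r-1)‼`. [folklore] -/
theorem integral_inner_pow_even_stdGaussian (v : W) (r : ℕ) :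
    ∫ x, ⟪v, x⟫_ℝ ^ (2 * r) ∂stdGaussian W = (‖v‖ ^ 2) ^ r * ((2 * r - 1 : ℕ)‼ : ℝ) := by
  have hφ : Measurable (fun x : W => ⟪v, x⟫_ℝ) := (continuous_const.inner continuous_id).measurable
  have hf : AEStronglyMeasurable (fun y : ℝ => y ^ (2 * r))
      ((stdGaussian W).map (fun x : W => ⟪v, x⟫_ℝ)) :=
    (measurable_id.pow_const _).aestronglyMeasurable
  rw [← integral_map hφ.aemeasurable hf, map_inner_stdGaussian,
    Literature.Probability.Distributions.integral_pow_even_gaussianReal,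
    Real.coe_toNNReal _ (by positivity)]

/-- Powers of a linear functional are integrable against the standard Gaussian. [folklore] -/
theorem integrable_inner_pow_stdGaussian (v : W) (n : ℕ) :
    Integrable (fun x : W => ⟪v, x⟫_ℝ ^ n) (stdGaussian W) := by
  have h := Literature.Probability.Distributions.integrable_pow_gaussianReal 0
    ((‖v‖ ^ 2).toNNReal) n
  rw [← map_inner_stdGaussian v] at h
  exact h.comp_measurable (continuous_const.inner continuous_id).measurable

/-- `∫ ⟪a, x⟫² dγ = ‖a‖²`. [folklore] -/
theorem integral_inner_sq_stdGaussian (a : W) :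
    ∫ x, ⟪a, x⟫_ℝ ^ 2 ∂stdGaussian W = ‖a‖ ^ 2 := by
  have h := integral_inner_pow_even_stdGaussian a 1
  norm_num [Nat.doubleFactorial] at h
  exact h

omit [FiniteDimensional ℝ W] [MeasurableSpace W] [BorelSpace W] in
/-- A combination of three linear functionals is the functional of the combined vector. [folklore] -/
theorem inner_comb (u v w : W) (α β δ : ℝ) (x : W) :
    α * ⟪u, x⟫_ℝ + β * ⟪v, x⟫_ℝ + δ * ⟪w, x⟫_ℝ = ⟪α • u + β • v + δ • w, x⟫_ℝ := by
  simp only [inner_add_left, real_inner_smul_left]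

omit [FiniteDimensional ℝ W] [MeasurableSpace W] [BorelSpace W] in
/-- The squared norm of a combination of three vectors through the Gram entries. [folklore] -/
theorem norm_sq_comb (u v w : W) (α β δ : ℝ) :
    ‖α • u + β • v + δ • w‖ ^ 2 =
      α ^ 2 * ‖u‖ ^ 2 + β ^ 2 * ‖v‖ ^ 2 + δ ^ 2 * ‖w‖ ^ 2 + 2 * α * β * ⟪u, v⟫_ℝ +
        2 * α * δ * ⟪u, w⟫_ℝ + 2 * β * δ * ⟪v, w⟫_ℝ := by
  rw [← real_inner_self_eq_norm_sq, ← real_inner_self_eq_norm_sq u,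
    ← real_inner_self_eq_norm_sq v, ← real_inner_self_eq_norm_sq w]
  simp only [inner_add_left, inner_add_right, real_inner_smul_left, real_inner_smul_right]
  rw [real_inner_comm u v, real_inner_comm u w, real_inner_comm v w]
  ring

/-- Even moments of a combination of three linear functionals under `γ`. [folklore] -/
theorem integral_comb_pow_even (u v w : W) (α β δ : ℝ) (r : ℕ) :
    ∫ x, (α * ⟪u, x⟫_ℝ + β * ⟪v, x⟫_ℝ + δ * ⟪w, x⟫_ℝ) ^ (2 * r) ∂stdGaussian W =
      (α ^ 2 * ‖u‖ ^ 2 + β ^ 2 * ‖v‖ ^ 2 + δ ^ 2 * ‖w‖ ^ 2 + 2 * α * β * ⟪u, v⟫_ℝ +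
        2 * α * δ * ⟪u, w⟫_ℝ + 2 * β * δ * ⟪v, w⟫_ℝ) ^ r * ((2 * r - 1 : ℕ)‼ : ℝ) := by
  simp_rw [inner_comb]
  rw [integral_inner_pow_even_stdGaussian, norm_sq_comb]

/-- Powers of a combination of three linear functionals are integrable under `γ`. [folklore] -/
theorem integrable_comb_pow (u v w : W) (α β δ : ℝ) (n : ℕ) :
    Integrable (fun x : W => (α * ⟪u, x⟫_ℝ + β * ⟪v, x⟫_ℝ + δ * ⟪w, x⟫_ℝ) ^ n)
      (stdGaussian W) := by
  simp_rw [inner_comb]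
  exact integrable_inner_pow_stdGaussian _ n

/-- Fourth moment of a combination: `3 q²` with `q` the Gram quadratic form. [folklore] -/
theorem integral_comb_pow_four (u v w : W) (α β δ : ℝ) :
    ∫ x, (α * ⟪u, x⟫_ℝ + β * ⟪v, x⟫_ℝ + δ * ⟪w, x⟫_ℝ) ^ 4 ∂stdGaussian W =
      3 * (α ^ 2 * ‖u‖ ^ 2 + β ^ 2 * ‖v‖ ^ 2 + δ ^ 2 * ‖w‖ ^ 2 + 2 * α * β * ⟪u, v⟫_ℝ +
        2 * α * δ * ⟪u, w⟫_ℝ + 2 * β * δ * ⟪v, w⟫_ℝ) ^ 2 := by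
  have h := integral_comb_pow_even u v w α β δ 2
  norm_num [Nat.doubleFactorial] at h
  rw [h, mul_comm]

/-- Sixth moment of a combination: `15 q³` with `q` the Gram quadratic form. [folklore] -/
theorem integral_comb_pow_six (u v w : W) (α β δ : ℝ) :
    ∫ x, (α * ⟪u, x⟫_ℝ + β * ⟪v, x⟫_ℝ + δ * ⟪w, x⟫_ℝ) ^ 6 ∂stdGaussian W =
      15 * (α ^ 2 * ‖u‖ ^ 2 + β ^ 2 * ‖v‖ ^ 2 + δ ^ 2 * ‖w‖ ^ 2 + 2 * α * β * ⟪u, v⟫_ℝ +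
        2 * α * δ * ⟪u, w⟫_ℝ + 2 * β * δ * ⟪v, w⟫_ℝ) ^ 3 := by
  have h := integral_comb_pow_even u v w α β δ 3
  norm_num [Nat.doubleFactorial] at h
  rw [h, mul_comm]

/-- **Isserlis at order four** for two linear functionals of the standard Gaussian:
`E[A² B²] = ‖a‖²‖b‖² + 2⟪a,b⟫²` (polarisation `12 x²y² = (x+y)⁴ + (x-y)⁴ - 2x⁴ - 2y⁴`). [folklore] -/
theorem integral_inner_sq_mul_sq (u v w : W) :
    ∫ x, ⟪u, x⟫_ℝ ^ 2 * ⟪v, x⟫_ℝ ^ 2 ∂stdGaussian W = ‖u‖ ^ 2 * ‖v‖ ^ 2 + 2 * ⟪u, v⟫_ℝ ^ 2 := by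
  -- adapted from Summits/QuantumFields/YangMills/Theorems/
  --   LangevinControlUVFemtoCurvatureSkewnessPermanentalRigidity.lean (`integral_linForm_sq_mul_sq`)
  let T : Fin 4 → Fin 3 → ℝ := ![![1, 1, 0], ![1, -1, 0], ![1, 0, 0], ![0, 1, 0]]
  let c : Fin 4 → ℝ := ![1, 1, -2, -2]
  let F : Fin 4 → W → ℝ := fun k x =>
    c k * (T k 0 * ⟪u, x⟫_ℝ + T k 1 * ⟪v, x⟫_ℝ + T k 2 * ⟪w, x⟫_ℝ) ^ 4
  have hpt : ∀ x : W, ⟪u, x⟫_ℝ ^ 2 * ⟪v, x⟫_ℝ ^ 2 = (1 / 12 : ℝ) * ∑ k, F k x := by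
    intro x
    simp [F, T, c, Fin.sum_univ_succ]
    ring
  have hint : ∀ k ∈ Finset.univ, Integrable (F k) (stdGaussian W) :=
    fun k _ => (integrable_comb_pow u v w (T k 0) (T k 1) (T k 2) 4).const_mul (c k)
  simp_rw [hpt]
  rw [integral_const_mul, integral_finsetSum _ hint]
  simp only [F, integral_const_mul, integral_comb_pow_four]
  simp [T, c, Fin.sum_univ_succ]
  ring

/-- **Isserlis at order six** for three linear functionals of the standard Gaussian:
`E[A² B² C²] = ‖a‖²‖b‖²‖c‖² + 2(⟪a,b⟫²‖c‖² + ⟪a,c⟫²‖b‖² + ⟪b,c⟫²‖a‖²) + 8⟪a,b⟫⟪b,c⟫⟪a,c⟫`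
(polarisation of `x²y²z²` into thirteen sixth powers of linear forms). [folklore] -/
theorem integral_inner_sq_mul_sq_mul_sq (u v w : W) :
    ∫ x, ⟪u, x⟫_ℝ ^ 2 * ⟪v, x⟫_ℝ ^ 2 * ⟪w, x⟫_ℝ ^ 2 ∂stdGaussian W =
      ‖u‖ ^ 2 * ‖v‖ ^ 2 * ‖w‖ ^ 2 +
        2 * (⟪u, v⟫_ℝ ^ 2 * ‖w‖ ^ 2 + ⟪u, w⟫_ℝ ^ 2 * ‖v‖ ^ 2 + ⟪v, w⟫_ℝ ^ 2 * ‖u‖ ^ 2) +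
        8 * ⟪u, v⟫_ℝ * ⟪v, w⟫_ℝ * ⟪u, w⟫_ℝ := by
  -- adapted from Summits/QuantumFields/YangMills/Theorems/
  --   LangevinControlUVFemtoCurvatureSkewnessPermanentalRigidity.lean
  --   (`integral_linForm_sq_mul_sq_mul_sq`)
  let T : Fin 13 → Fin 3 → ℝ :=
    ![![1, 1, 1], ![1, 1, -1], ![1, -1, 1], ![1, -1, -1], ![1, 1, 0], ![1, -1, 0], ![0, 1, 1],
      ![0, 1, -1], ![1, 0, 1], ![1, 0, -1], ![1, 0, 0], ![0, 1, 0], ![0, 0, 1]]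
  let c : Fin 13 → ℝ := ![1, 1, 1, 1, -2, -2, -2, -2, -2, -2, 4, 4, 4]
  let F : Fin 13 → W → ℝ := fun k x =>
    c k * (T k 0 * ⟪u, x⟫_ℝ + T k 1 * ⟪v, x⟫_ℝ + T k 2 * ⟪w, x⟫_ℝ) ^ 6
  have hpt : ∀ x : W, ⟪u, x⟫_ℝ ^ 2 * ⟪v, x⟫_ℝ ^ 2 * ⟪w, x⟫_ℝ ^ 2 =
      (1 / 360 : ℝ) * ∑ k, F k x := by
    intro x
    simp [F, T, c, Fin.sum_univ_succ]
    ring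
  have hint : ∀ k ∈ Finset.univ, Integrable (F k) (stdGaussian W) :=
    fun k _ => (integrable_comb_pow u v w (T k 0) (T k 1) (T k 2) 6).const_mul (c k)
  simp_rw [hpt]
  rw [integral_const_mul, integral_finsetSum _ hint]
  simp only [F, integral_const_mul, integral_comb_pow_six]
  simp [T, c, Fin.sum_univ_succ]
  ring

/-- **All finite products of linear functionals are `γ`-integrable**: `|∏ᵢ ⟪vᵢ, x⟫| ≤ (∏ᵢ ‖vᵢ‖) ‖x‖ᵐ`
and Gaussian measures have moments of all orders (Fernique; Mathlib's `IsGaussian.memLp_id`). [folklore] -/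
theorem integrable_prod_inner_stdGaussian (m : ℕ) (v : Fin m → W) :
    Integrable (fun x : W => ∏ i, ⟪v i, x⟫_ℝ) (stdGaussian W) := by
  have hnorm : Integrable (fun x : W => ‖x‖ ^ m) (stdGaussian W) :=
    (IsGaussian.memLp_id (stdGaussian W) (m : ℝ≥0∞) (ENNReal.natCast_ne_top m)).integrable_norm_pow'
  have hcont : Continuous (fun x : W => ∏ i, ⟪v i, x⟫_ℝ) :=
    continuous_finsetProd _ fun i _ => continuous_const.inner continuous_id
  refine (hnorm.const_mul (∏ i, ‖v i‖)).mono' hcont.aestronglyMeasurable (ae_of_all _ fun x => ?_)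
  rw [Real.norm_eq_abs, Finset.abs_prod]
  calc ∏ i, |⟪v i, x⟫_ℝ| ≤ ∏ i, (‖v i‖ * ‖x‖) :=
        Finset.prod_le_prod (fun i _ => abs_nonneg _) (fun i _ => abs_real_inner_le_norm _ _)
    _ = (∏ i, ‖v i‖) * ‖x‖ ^ m := by
        rw [Finset.prod_mul_distrib, Finset.prod_const, Finset.card_univ, Fintype.card_fin]

/-- `A² B²` is `γ`-integrable. [folklore] -/
theorem integrable_inner_sq_mul_sq (a b : W) :
    Integrable (fun x : W => ⟪a, x⟫_ℝ ^ 2 * ⟪b, x⟫_ℝ ^ 2) (stdGaussian W) := by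
  refine (integrable_prod_inner_stdGaussian 4 ![a, a, b, b]).congr (ae_of_all _ fun x => ?_)
  simp [Fin.prod_univ_succ]
  ring

/-- `A² B² C²` is `γ`-integrable. [folklore] -/
theorem integrable_inner_sq_mul_sq_mul_sq (a b c : W) :
    Integrable (fun x : W => ⟪a, x⟫_ℝ ^ 2 * ⟪b, x⟫_ℝ ^ 2 * ⟪c, x⟫_ℝ ^ 2) (stdGaussian W) := by
  refine (integrable_prod_inner_stdGaussian 6 ![a, a, b, b, c, c]).congr (ae_of_all _ fun x => ?_)
  simp [Fin.prod_univ_succ]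
  ring

/-- **Covariance of Wick squares**: `E[(A² - ‖a‖²)(B² - ‖b‖²)] = 2⟪a,b⟫²`. [folklore] -/
theorem integral_wickSquare_mul_wickSquare (a b : W) :
    ∫ x, (⟪a, x⟫_ℝ ^ 2 - ‖a‖ ^ 2) * (⟪b, x⟫_ℝ ^ 2 - ‖b‖ ^ 2) ∂stdGaussian W = 2 * ⟪a, b⟫_ℝ ^ 2 := by
  have e : ∀ x : W, (⟪a, x⟫_ℝ ^ 2 - ‖a‖ ^ 2) * (⟪b, x⟫_ℝ ^ 2 - ‖b‖ ^ 2) =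
      ⟪a, x⟫_ℝ ^ 2 * ⟪b, x⟫_ℝ ^ 2 - ‖a‖ ^ 2 * ⟪b, x⟫_ℝ ^ 2 - ‖b‖ ^ 2 * ⟪a, x⟫_ℝ ^ 2 +
        ‖a‖ ^ 2 * ‖b‖ ^ 2 := by
    intro x; ring
  simp_rw [e]
  have i1 : Integrable (fun x : W => ⟪a, x⟫_ℝ ^ 2 * ⟪b, x⟫_ℝ ^ 2) (stdGaussian W) :=
    integrable_inner_sq_mul_sq a b
  have i2 : Integrable (fun x : W => ‖a‖ ^ 2 * ⟪b, x⟫_ℝ ^ 2) (stdGaussian W) :=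
    (integrable_inner_pow_stdGaussian b 2).const_mul _
  have i3 : Integrable (fun x : W => ‖b‖ ^ 2 * ⟪a, x⟫_ℝ ^ 2) (stdGaussian W) :=
    (integrable_inner_pow_stdGaussian a 2).const_mul _
  have i4 : Integrable (fun _ : W => ‖a‖ ^ 2 * ‖b‖ ^ 2) (stdGaussian W) := integrable_const _
  have i12 : Integrable (fun x : W => ⟪a, x⟫_ℝ ^ 2 * ⟪b, x⟫_ℝ ^ 2 - ‖a‖ ^ 2 * ⟪b, x⟫_ℝ ^ 2)
      (stdGaussian W) := i1.sub i2
  have i123 : Integrable (fun x : W => ⟪a, x⟫_ℝ ^ 2 * ⟪b, x⟫_ℝ ^ 2 - ‖a‖ ^ 2 * ⟪b, x⟫_ℝ ^ 2 -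
      ‖b‖ ^ 2 * ⟪a, x⟫_ℝ ^ 2) (stdGaussian W) := i12.sub i3
  rw [integral_add i123 i4, integral_sub i12 i3, integral_sub i1 i2, integral_const_mul,
    integral_const_mul, integral_const, integral_inner_sq_mul_sq a b a, integral_inner_sq_stdGaussian,
    integral_inner_sq_stdGaussian]
  simp only [probReal_univ, smul_eq_mul, one_mul]
  ring

/-- **Third moment of Wick squares**:
`E[(A² - ‖a‖²)(B² - ‖b‖²)(C² - ‖c‖²)] = 8⟪a,b⟫⟪b,c⟫⟪c,a⟫`. [folklore] -/
theorem integral_wickSquare_mul_wickSquare_mul_wickSquare (a b c : W) :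
    ∫ x, (⟪a, x⟫_ℝ ^ 2 - ‖a‖ ^ 2) * (⟪b, x⟫_ℝ ^ 2 - ‖b‖ ^ 2) * (⟪c, x⟫_ℝ ^ 2 - ‖c‖ ^ 2)
        ∂stdGaussian W = 8 * (⟪a, b⟫_ℝ * ⟪b, c⟫_ℝ * ⟪c, a⟫_ℝ) := by
  have e : ∀ x : W, (⟪a, x⟫_ℝ ^ 2 - ‖a‖ ^ 2) * (⟪b, x⟫_ℝ ^ 2 - ‖b‖ ^ 2) * (⟪c, x⟫_ℝ ^ 2 - ‖c‖ ^ 2) =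
      ⟪a, x⟫_ℝ ^ 2 * ⟪b, x⟫_ℝ ^ 2 * ⟪c, x⟫_ℝ ^ 2 - ‖a‖ ^ 2 * (⟪b, x⟫_ℝ ^ 2 * ⟪c, x⟫_ℝ ^ 2) -
        ‖b‖ ^ 2 * (⟪a, x⟫_ℝ ^ 2 * ⟪c, x⟫_ℝ ^ 2) - ‖c‖ ^ 2 * (⟪a, x⟫_ℝ ^ 2 * ⟪b, x⟫_ℝ ^ 2) +
        ‖a‖ ^ 2 * ‖b‖ ^ 2 * ⟪c, x⟫_ℝ ^ 2 + ‖a‖ ^ 2 * ‖c‖ ^ 2 * ⟪b, x⟫_ℝ ^ 2 +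
        ‖b‖ ^ 2 * ‖c‖ ^ 2 * ⟪a, x⟫_ℝ ^ 2 - ‖a‖ ^ 2 * ‖b‖ ^ 2 * ‖c‖ ^ 2 := by
    intro x; ring
  simp_rw [e]
  -- the eight integrable pieces
  have i1 : Integrable (fun x : W => ⟪a, x⟫_ℝ ^ 2 * ⟪b, x⟫_ℝ ^ 2 * ⟪c, x⟫_ℝ ^ 2) (stdGaussian W) :=
    integrable_inner_sq_mul_sq_mul_sq a b c
  have i2 : Integrable (fun x : W => ‖a‖ ^ 2 * (⟪b, x⟫_ℝ ^ 2 * ⟪c, x⟫_ℝ ^ 2)) (stdGaussian W) :=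
    (integrable_inner_sq_mul_sq b c).const_mul _
  have i3 : Integrable (fun x : W => ‖b‖ ^ 2 * (⟪a, x⟫_ℝ ^ 2 * ⟪c, x⟫_ℝ ^ 2)) (stdGaussian W) :=
    (integrable_inner_sq_mul_sq a c).const_mul _
  have i4 : Integrable (fun x : W => ‖c‖ ^ 2 * (⟪a, x⟫_ℝ ^ 2 * ⟪b, x⟫_ℝ ^ 2)) (stdGaussian W) :=
    (integrable_inner_sq_mul_sq a b).const_mul _
  have i5 : Integrable (fun x : W => ‖a‖ ^ 2 * ‖b‖ ^ 2 * ⟪c, x⟫_ℝ ^ 2) (stdGaussian W) :=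
    (integrable_inner_pow_stdGaussian c 2).const_mul _
  have i6 : Integrable (fun x : W => ‖a‖ ^ 2 * ‖c‖ ^ 2 * ⟪b, x⟫_ℝ ^ 2) (stdGaussian W) :=
    (integrable_inner_pow_stdGaussian b 2).const_mul _
  have i7 : Integrable (fun x : W => ‖b‖ ^ 2 * ‖c‖ ^ 2 * ⟪a, x⟫_ℝ ^ 2) (stdGaussian W) :=
    (integrable_inner_pow_stdGaussian a 2).const_mul _
  have i8 : Integrable (fun _ : W => ‖a‖ ^ 2 * ‖b‖ ^ 2 * ‖c‖ ^ 2) (stdGaussian W) :=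
    integrable_const _
  have i12 : Integrable (fun x : W => ⟪a, x⟫_ℝ ^ 2 * ⟪b, x⟫_ℝ ^ 2 * ⟪c, x⟫_ℝ ^ 2 -
      ‖a‖ ^ 2 * (⟪b, x⟫_ℝ ^ 2 * ⟪c, x⟫_ℝ ^ 2)) (stdGaussian W) := i1.sub i2
  have i123 : Integrable (fun x : W => ⟪a, x⟫_ℝ ^ 2 * ⟪b, x⟫_ℝ ^ 2 * ⟪c, x⟫_ℝ ^ 2 -
      ‖a‖ ^ 2 * (⟪b, x⟫_ℝ ^ 2 * ⟪c, x⟫_ℝ ^ 2) - ‖b‖ ^ 2 * (⟪a, x⟫_ℝ ^ 2 * ⟪c, x⟫_ℝ ^ 2))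
      (stdGaussian W) := i12.sub i3
  have i1234 : Integrable (fun x : W => ⟪a, x⟫_ℝ ^ 2 * ⟪b, x⟫_ℝ ^ 2 * ⟪c, x⟫_ℝ ^ 2 -
      ‖a‖ ^ 2 * (⟪b, x⟫_ℝ ^ 2 * ⟪c, x⟫_ℝ ^ 2) - ‖b‖ ^ 2 * (⟪a, x⟫_ℝ ^ 2 * ⟪c, x⟫_ℝ ^ 2) -
      ‖c‖ ^ 2 * (⟪a, x⟫_ℝ ^ 2 * ⟪b, x⟫_ℝ ^ 2)) (stdGaussian W) := i123.sub i4
  have i12345 : Integrable (fun x : W => ⟪a, x⟫_ℝ ^ 2 * ⟪b, x⟫_ℝ ^ 2 * ⟪c, x⟫_ℝ ^ 2 -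
      ‖a‖ ^ 2 * (⟪b, x⟫_ℝ ^ 2 * ⟪c, x⟫_ℝ ^ 2) - ‖b‖ ^ 2 * (⟪a, x⟫_ℝ ^ 2 * ⟪c, x⟫_ℝ ^ 2) -
      ‖c‖ ^ 2 * (⟪a, x⟫_ℝ ^ 2 * ⟪b, x⟫_ℝ ^ 2) + ‖a‖ ^ 2 * ‖b‖ ^ 2 * ⟪c, x⟫_ℝ ^ 2)
      (stdGaussian W) := i1234.add i5
  have i123456 : Integrable (fun x : W => ⟪a, x⟫_ℝ ^ 2 * ⟪b, x⟫_ℝ ^ 2 * ⟪c, x⟫_ℝ ^ 2 -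
      ‖a‖ ^ 2 * (⟪b, x⟫_ℝ ^ 2 * ⟪c, x⟫_ℝ ^ 2) - ‖b‖ ^ 2 * (⟪a, x⟫_ℝ ^ 2 * ⟪c, x⟫_ℝ ^ 2) -
      ‖c‖ ^ 2 * (⟪a, x⟫_ℝ ^ 2 * ⟪b, x⟫_ℝ ^ 2) + ‖a‖ ^ 2 * ‖b‖ ^ 2 * ⟪c, x⟫_ℝ ^ 2 +
      ‖a‖ ^ 2 * ‖c‖ ^ 2 * ⟪b, x⟫_ℝ ^ 2) (stdGaussian W) := i12345.add i6
  have i1234567 : Integrable (fun x : W => ⟪a, x⟫_ℝ ^ 2 * ⟪b, x⟫_ℝ ^ 2 * ⟪c, x⟫_ℝ ^ 2 -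
      ‖a‖ ^ 2 * (⟪b, x⟫_ℝ ^ 2 * ⟪c, x⟫_ℝ ^ 2) - ‖b‖ ^ 2 * (⟪a, x⟫_ℝ ^ 2 * ⟪c, x⟫_ℝ ^ 2) -
      ‖c‖ ^ 2 * (⟪a, x⟫_ℝ ^ 2 * ⟪b, x⟫_ℝ ^ 2) + ‖a‖ ^ 2 * ‖b‖ ^ 2 * ⟪c, x⟫_ℝ ^ 2 +
      ‖a‖ ^ 2 * ‖c‖ ^ 2 * ⟪b, x⟫_ℝ ^ 2 + ‖b‖ ^ 2 * ‖c‖ ^ 2 * ⟪a, x⟫_ℝ ^ 2) (stdGaussian W) :=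
    i123456.add i7
  rw [integral_sub i1234567 i8, integral_add i123456 i7, integral_add i12345 i6,
    integral_add i1234 i5, integral_sub i123 i4, integral_sub i12 i3, integral_sub i1 i2,
    integral_const_mul, integral_const_mul, integral_const_mul, integral_const_mul,
    integral_const_mul, integral_const_mul, integral_const,
    integral_inner_sq_mul_sq_mul_sq, integral_inner_sq_mul_sq b c a, integral_inner_sq_mul_sq a c b,
    integral_inner_sq_mul_sq a b c, integral_inner_sq_stdGaussian, integral_inner_sq_stdGaussian,
    integral_inner_sq_stdGaussian, real_inner_comm a c]
  simp only [probReal_univ, smul_eq_mul, one_mul]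
  ring

end WickSquaresHelpers

/-- **Stub D — Gaussian Wick squares: covariance and third moment** (line `Sketch` of crux
`SelfNormalisedSkewness`, registered signature verbatim).  For the standard Gaussian `γ` of a
finite-dimensional real inner product space and vectors `a b c`, the centred squares
`⟪a,x⟫² - ‖a‖²` satisfy `E[(A²-|a|²)(B²-|b|²)] = 2⟪a,b⟫²` and
`E[(A²-|a|²)(B²-|b|²)(C²-|c|²)] = 8⟪a,b⟫⟪b,c⟫⟪c,a⟫` (Isserlis 1918 / Wick), and products of linear
functionals are integrable. [folklore] -/
theorem stub_wickSquares {W : Type} [NormedAddCommGroup W] [InnerProductSpace ℝ W] [FiniteDimensional ℝ W] [MeasurableSpace W] [BorelSpace W] : (∀ (m : ℕ) (v : Fin m → W), m ≤ 6 → Integrable (fun x : W => ∏ i, ⟪v i, x⟫_ℝ) (stdGaussian W)) ∧ (∀ a b : W, ∫ x, (⟪a, x⟫_ℝ ^ 2 - ‖a‖ ^ 2) * (⟪b, x⟫_ℝ ^ 2 - ‖b‖ ^ 2) ∂(stdGaussian W) = 2 * ⟪a, b⟫_ℝ ^ 2) ∧ (∀ a b c : W, ∫ x, (⟪a, x⟫_ℝ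 ^ 2 - ‖a‖ ^ 2) * (⟪b, x⟫_ℝ ^ 2 - ‖b‖ ^ 2) * (⟪c, x⟫_ℝ ^ 2 - ‖c‖ ^ 2) ∂(stdGaussian W) = 8 * (⟪a, b⟫_ℝ * ⟪b, c⟫_ℝ * ⟪c, a⟫_ℝ)) := by
  exact ⟨fun m v _ => integrable_prod_inner_stdGaussian m v, integral_wickSquare_mul_wickSquare,
    integral_wickSquare_mul_wickSquare_mul_wickSquare⟩

end Summit.QuantumFields.YangMills.Theorems.SelfNormalisedSkewness.Negative

end
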